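import Summits.QuantumFields.YangMills.Theorems.VirialFluxGapRingStabilizerRigidity
import Summits.QuantumFields.YangMills.Theorems.VirialFluxGapTwistEaterSignClass
import Summits.QuantumFields.YangMills.Theorems.VirialFluxGapRingGaugeAction
import HarnessLib

/-!
# Tube reduction: a ring history near the zero set of `F_z` is, after a gauge transformation, near a REFERENCE twist-eater ring
# (layer (B), chart-free input `hout`/tube coverage, of the DIRECT Laplace road to ⟨stmt-QuantumFields-24204⟩ `VirialFluxGap.SharpTwistedLaplace`)

Helper module (free-hands work of width seat ym-line-sfw-p2-w3 g56, cell ym-idea-1; `--supports 24204`).  The separation hypothesis `hout` of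
✓`QuantitativeLaplace.laplaceMethod_quantitative_orbit` / `…_sum_of_tubes` is fed by ✓`ringDeficit_floor_off_tube` (⟨24320⟩): off the chordal
tube `{dist²(·, Z) < ρ}` around the zero set `Z` of `F_z` the deficit is `≥ η₀`.  To turn «chordally `ρ`-close to `Z`» into «inside a chart tube
`K·σ_s(B_R)` of a reference ring `R_s`» the slice chart (B2) only needs LOCAL surjectivity at the reference POINT `R_s`, because of the reduction
proved here (chart-free, from ✓`exists_combGauge_of_ringDeficit_eq_zero` + ✓`exists_conj_signClass_of_twistEater`):

* §1 `ringDist_ringGaugeAct` — the chordal ring distance (inlined, as in the Theses) is invariant under the simultaneous gauge action;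
* §2 `gaugeTransform_const_combFlat` — a constant gauge transformation conjugates a comb-form ring into
  the REFERENCE ring `R_s = (combFlat w_s; λ·C₀)`, `w_s(k) = centreElem(s_k)·(N₀ if z_k else 1)`, of its sign class;
* §3 ★★ `exists_gauge_ringDist_reference_lt` — for `L ≥ 2`, `z ≠ 0`, a reference pure orthogonal pair `(N₀, C₀)`, EVERY ring `P` and every zero
  `Q` of `F_z` with `ringDist(P, Q) < ρ`: there are a sign class `s` and a gauge field `h` with `ringDist(h·P, R_s) < ρ`;
  ★ `exists_gauge_ringDist_reference_lt_of_sInf_lt` — the same from `sInf_{Q ∈ Z} ringDist(P, Q) < ρ` (the tube of the Theses), given that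
  `Z` is non-empty;
* §4 `fd_le_two_sqrt_of_ringDist_le` — chordal closeness `ringDist(P, R) ≤ D` gives per-link ∕ per-site Frobenius closeness `≤ 2√D` on EVERY
  slice and on the seam (the sup-norm neighbourhood in which B2's local chart surjectivity is to be applied).

Everything here is PROVED; no definitions, no named facts (namespace `Summit.QuantumFields.YangMills.Theorems.VirialFluxGap.RingDeficit`).
HONEST FRAMING: lattice bookkeeping; ⟨24204⟩, ⟨24319⟩ and every rung stay OPEN; the Yang–Mills mass gap (Clay) is NOT touched; no summit
is proved by a line.

## References
* M. Lüscher, Nucl. Phys. B219 (1983), §2. [Luscher1983]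
* A. González-Arroyo, C. P. Korthals Altes, Nucl. Phys. B311 (1988) §2. [GonzalezarroyoAltes1988]
-/

set_option autoImplicit false

noncomputable section

open scoped Quaternion Matrix BigOperators
open Literature.MathematicalPhysics.QuantumFieldTheory hiding SU2
open Literature.MathematicalPhysics.QuantumLattice
open Summit.QuantumFields.YangMills.Theorems.FemtoTransferGap
open Summit.QuantumFields.YangMills.Theorems.FemtoTransferGap.TT
open Summit.QuantumFields.YangMills.Theorems.FemtoTransferGap.TwoLattice
open Summit.QuantumFields.YangMills.Theorems.FemtoTransferGap.TwoLattice.Flat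
open Summit.QuantumFields.YangMills.Theorems.FemtoTransferGap.TwoLattice.Cov
open Summit.QuantumFields.YangMills.Theorems.ToronValleyVolume.Lojasiewicz
open Summit.QuantumFields.YangMills.Theorems.TwistEaterVolume.Quadratic
open Summit.QuantumFields.YangMills.Theorems.QuantitativeLaplace

namespace Summit.QuantumFields.YangMills.Theorems.VirialFluxGap.RingDeficit

variable {L : ℕ} [NeZero L]

/-! ## §1 Gauge invariance of the chordal ring distance -/

/-- ★ **The chordal ring distance is gauge invariant**: `ringDist(h·P, h·Q) = ringDist(P, Q)` (inlined chordal distance of the Theses; the action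
as in ✓`…RingGaugeAction`). [folklore] -/
theorem ringDist_ringGaugeAct (h : Site 3 L → SU2) (P Q : (Fin (2 * L - 1 + 1) → GaugeConfig 3 L SU2) × (Site 3 L → SU2)) :
    (∑ i : Fin (2 * L - 1 + 1), (6 * (L : ℝ) ^ 3 - timeCoupling su2Rep (gaugeTransform h (P.1 i)) (gaugeTransform h (Q.1 i)))) +
        ∑ x : Site 3 L, (2 - ((su2Rep ((h * P.2 * h⁻¹) x * ((h * Q.2 * h⁻¹) x)⁻¹)).trace).re) =
      (∑ i : Fin (2 * L - 1 + 1), (6 * (L : ℝ) ^ 3 - timeCoupling su2Rep (P.1 i) (Q.1 i))) +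
        ∑ x : Site 3 L, (2 - ((su2Rep (P.2 x * (Q.2 x)⁻¹)).trace).re) := by
  congr 1
  · exact Finset.sum_congr rfl fun i _ => by rw [timeCoupling_gaugeTransform]
  · refine Finset.sum_congr rfl fun x _ => ?_
    have e : (h * P.2 * h⁻¹) x * ((h * Q.2 * h⁻¹) x)⁻¹ = h x * (P.2 x * (Q.2 x)⁻¹) * (h x)⁻¹ := by
      simp only [Pi.mul_apply, Pi.inv_apply, mul_inv_rev, inv_inv]; group
    rw [e, map_mul, map_mul, Matrix.trace_mul_cycle, ← map_mul, inv_mul_cancel, map_one, one_mul]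

/-! ## §2 Constant gauge transformations of comb-form rings -/

omit [NeZero L] in
/-- A constant gauge transformation conjugates a comb-flat configuration: `g₀ · combFlat w = combFlat (g₀ w g₀⁻¹)`. [folklore] -/
theorem gaugeTransform_const_combFlat [Fact (1 < L)] (g₀ : SU2) (w : Fin 3 → SU2) :
    gaugeTransform (fun _ : Site 3 L => g₀) (combFlat w) = combFlat (L := L) (fun k => g₀ * w k * g₀⁻¹) := by
  funext e
  rw [show gaugeTransform (fun _ : Site 3 L => g₀) (combFlat w) e = g₀ * combFlat w e * g₀⁻¹ from rfl, combFlat_apply, combFlat_apply]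
  split_ifs
  · rfl
  · rw [mul_one, mul_inv_cancel]

/-! ## §3 ★★ Reduction of a neighbourhood of the zero set to neighbourhoods of the reference rings -/

/-- ★★ **Tube reduction.**  For `L ≥ 2`, `z ≠ 0`, a twist-sign field `λ`, a reference pair `(N₀, C₀)` of trace-free elements with orthogonal
quaternion axes, EVERY ring `P` and every zero `Q` of `F_z` at chordal distance `< ρ` from `P`: for some sign class `s` and gauge field `h`,
`h·P` is at chordal distance `< ρ` from the reference ring `R_s = (combFlat w_s; λ·C₀)`, `w_s(k) = centreElem(s_k)·(N₀ if z_k else 1)`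
(`h = g₀·t`: the tree gauge `t` of the slice of `Q` followed by the constant conjugation `g₀` into the sign class). [cite: Luscher1983, §2]
[cite: GonzalezarroyoAltes1988, §2] -/
theorem exists_gauge_ringDist_reference_lt (hL : 2 ≤ L) {z : Fin 3 → Bool} (hz : z ≠ fun _ => false)
    {lam : Site 3 L → SU2} (hlamc : ∀ x, lam x ∈ Subgroup.center SU2) (hlam0 : lam 0 = 1)
    (hlamflip : ∀ (x : Site 3 L) (k : Fin 3), (x k = 0 ∨ x k = -1) → lam (x.shift k) = lam x * centreElem (z k))
    (hlamstay : ∀ (x : Site 3 L) (k : Fin 3), x k ≠ 0 → x k ≠ -1 → lam (x.shift k) = lam x)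
    {N₀ C₀ : SU2} (hN : (su2Quat N₀).re = 0) (hC : (su2Quat C₀).re = 0)
    (hNC : (su2Quat N₀).imI * (su2Quat C₀).imI + (su2Quat N₀).imJ * (su2Quat C₀).imJ + (su2Quat N₀).imK * (su2Quat C₀).imK = 0)
    (P Q : (Fin (2 * L - 1 + 1) → GaugeConfig 3 L SU2) × (Site 3 L → SU2)) (hQ : ringDeficit L z Q = 0) {ρ : ℝ}
    (hPQ : (∑ i : Fin (2 * L - 1 + 1), (6 * (L : ℝ) ^ 3 - timeCoupling su2Rep (P.1 i) (Q.1 i))) +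
        ∑ x : Site 3 L, (2 - ((su2Rep (P.2 x * (Q.2 x)⁻¹)).trace).re) < ρ) :
    ∃ (s : Fin 3 → Bool) (h : Site 3 L → SU2),
      (∑ i : Fin (2 * L - 1 + 1), (6 * (L : ℝ) ^ 3 -
          timeCoupling su2Rep (gaugeTransform h (P.1 i)) (combFlat (fun k => centreElem (s k) * (if z k then N₀ else 1))))) +
        ∑ x : Site 3 L, (2 - ((su2Rep ((h * P.2 * h⁻¹) x * (lam x * C₀)⁻¹)).trace).re) < ρ := by
  haveI : Fact (1 < L) := ⟨hL⟩
  obtain ⟨t, w, c, hww, hcw, hsl, hsm⟩ := exists_combGauge_of_ringDeficit_eq_zero hL z hlamc hlam0 hlamflip hlamstay Q hQ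
  obtain ⟨s, g₀, hws, hcC⟩ := exists_conj_signClass_of_twistEater z hz hww hcw hN hC hNC
  refine ⟨s, fun x => g₀ * t x, ?_⟩
  -- `h·Q` is the reference ring: slices …
  have hws' : (fun k => g₀ * w k * g₀⁻¹) = fun k => centreElem (s k) * (if z k then N₀ else 1) := funext hws
  have h1 : ∀ i, gaugeTransform (fun x => g₀ * t x) (Q.1 i) = combFlat (fun k => centreElem (s k) * (if z k then N₀ else 1)) := by
    intro i
    rw [hsl i, gaugeTransform_gaugeTransform]
    have e : ((fun x => g₀ * t x) * t⁻¹ : Site 3 L → SU2) = fun _ => g₀ := by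
      funext x; simp only [Pi.mul_apply, Pi.inv_apply, mul_inv_cancel_right]
    rw [e, gaugeTransform_const_combFlat, hws']
  -- … and seam
  have h2 : ∀ x, ((fun x => g₀ * t x) * Q.2 * (fun x => g₀ * t x)⁻¹ : Site 3 L → SU2) x = lam x * C₀ := by
    intro x
    simp only [Pi.mul_apply, Pi.inv_apply, hsm x, mul_inv_rev]
    have hl : ∀ g : SU2, lam x * g = g * lam x := fun g => centre_comm (hlamc x) g
    rw [← hcC]
    calc g₀ * t x * ((t x)⁻¹ * (lam x * c) * t x) * ((t x)⁻¹ * g₀⁻¹) = (g₀ * lam x) * c * g₀⁻¹ := by group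
      _ = (lam x * g₀) * c * g₀⁻¹ := by rw [hl g₀]
      _ = lam x * (g₀ * c * g₀⁻¹) := by group
  -- gauge invariance of the chordal distance
  have hinv := ringDist_ringGaugeAct (fun x => g₀ * t x) P Q
  simp only [h1, h2] at hinv
  rw [hinv]
  exact hPQ

/-- ★ **Tube reduction from the `sInf` tube of the Theses.**  If the zero set of `F_z` is non-empty and the chordal distance from `P` to it
(an `sInf`) is `< ρ`, then for some sign class `s` and gauge field `h`, `h·P` is within chordal distance `ρ` of the reference ring `R_s`.
[cite: Luscher1983, §2] -/
theorem exists_gauge_ringDist_reference_lt_of_sInf_lt (hL : 2 ≤ L) {z : Fin 3 → Bool} (hz : z ≠ fun _ => false)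
    {lam : Site 3 L → SU2} (hlamc : ∀ x, lam x ∈ Subgroup.center SU2) (hlam0 : lam 0 = 1)
    (hlamflip : ∀ (x : Site 3 L) (k : Fin 3), (x k = 0 ∨ x k = -1) → lam (x.shift k) = lam x * centreElem (z k))
    (hlamstay : ∀ (x : Site 3 L) (k : Fin 3), x k ≠ 0 → x k ≠ -1 → lam (x.shift k) = lam x)
    {N₀ C₀ : SU2} (hN : (su2Quat N₀).re = 0) (hC : (su2Quat C₀).re = 0)
    (hNC : (su2Quat N₀).imI * (su2Quat C₀).imI + (su2Quat N₀).imJ * (su2Quat C₀).imJ + (su2Quat N₀).imK * (su2Quat C₀).imK = 0)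
    (hZ : ∃ Q₀ : (Fin (2 * L - 1 + 1) → GaugeConfig 3 L SU2) × (Site 3 L → SU2), ringDeficit L z Q₀ = 0)
    (P : (Fin (2 * L - 1 + 1) → GaugeConfig 3 L SU2) × (Site 3 L → SU2)) {ρ : ℝ}
    (hP : sInf ((fun Q : (Fin (2 * L - 1 + 1) → GaugeConfig 3 L SU2) × (Site 3 L → SU2) =>
        (∑ i : Fin (2 * L - 1 + 1), (6 * (L : ℝ) ^ 3 - timeCoupling su2Rep (P.1 i) (Q.1 i))) +
          ∑ x : Site 3 L, (2 - ((su2Rep (P.2 x * (Q.2 x)⁻¹)).trace).re)) '' {Q | ringDeficit L z Q = 0}) < ρ) :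
    ∃ (s : Fin 3 → Bool) (h : Site 3 L → SU2),
      (∑ i : Fin (2 * L - 1 + 1), (6 * (L : ℝ) ^ 3 -
          timeCoupling su2Rep (gaugeTransform h (P.1 i)) (combFlat (fun k => centreElem (s k) * (if z k then N₀ else 1))))) +
        ∑ x : Site 3 L, (2 - ((su2Rep ((h * P.2 * h⁻¹) x * (lam x * C₀)⁻¹)).trace).re) < ρ := by
  obtain ⟨Q₀, hQ₀⟩ := hZ
  have hne : ((fun Q : (Fin (2 * L - 1 + 1) → GaugeConfig 3 L SU2) × (Site 3 L → SU2) =>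
      (∑ i : Fin (2 * L - 1 + 1), (6 * (L : ℝ) ^ 3 - timeCoupling su2Rep (P.1 i) (Q.1 i))) +
        ∑ x : Site 3 L, (2 - ((su2Rep (P.2 x * (Q.2 x)⁻¹)).trace).re)) '' {Q | ringDeficit L z Q = 0}).Nonempty :=
    ⟨_, Q₀, hQ₀, rfl⟩
  obtain ⟨d, ⟨Q, hQ, rfl⟩, hd⟩ := exists_lt_of_csInf_lt hne hP
  exact exists_gauge_ringDist_reference_lt hL hz hlamc hlam0 hlamflip hlamstay hN hC hNC P Q hQ hd

/-! ## §4 From chordal closeness to per-link closeness -/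

/-- ★ **Chordal closeness is per-link closeness**: if `ringDist(P, R) ≤ D` then every link of every slice of `P` is within `2√D` (Frobenius) of the
corresponding link of `R`, and so is every site of the seam. [folklore] -/
theorem fd_le_two_sqrt_of_ringDist_le (P R : (Fin (2 * L - 1 + 1) → GaugeConfig 3 L SU2) × (Site 3 L → SU2)) {D : ℝ}
    (hD : (∑ i : Fin (2 * L - 1 + 1), (6 * (L : ℝ) ^ 3 - timeCoupling su2Rep (P.1 i) (R.1 i))) +
        ∑ x : Site 3 L, (2 - ((su2Rep (P.2 x * (R.2 x)⁻¹)).trace).re) ≤ D) :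
    (∀ (i : Fin (2 * L - 1 + 1)) (e : Edge 3 L), fd (P.1 i e) (R.1 i e) ≤ 2 * Real.sqrt D) ∧
      ∀ x : Site 3 L, fd (P.2 x) (R.2 x) ≤ 2 * Real.sqrt D := by
  have hseam_eq : ∀ x : Site 3 L, 2 - ((su2Rep (P.2 x * (R.2 x)⁻¹)).trace).re = ‖su2Quat (P.2 x) - su2Quat (R.2 x)‖ ^ 2 := fun x => by
    rw [ConstTube.re_trace_su2Rep_mul_inv_eq_norm]; ring
  have hslice_nonneg : ∀ i : Fin (2 * L - 1 + 1), 0 ≤ 6 * (L : ℝ) ^ 3 - timeCoupling su2Rep (P.1 i) (R.1 i) :=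
    fun i => by linarith [timeCoupling_su2Rep_le (P.1 i) (R.1 i)]
  have hseam_nonneg : ∀ x : Site 3 L, 0 ≤ 2 - ((su2Rep (P.2 x * (R.2 x)⁻¹)).trace).re := fun x => by rw [hseam_eq]; positivity
  have hS1 : 0 ≤ ∑ i : Fin (2 * L - 1 + 1), (6 * (L : ℝ) ^ 3 - timeCoupling su2Rep (P.1 i) (R.1 i)) :=
    Finset.sum_nonneg fun i _ => hslice_nonneg i
  have hS2 : 0 ≤ ∑ x : Site 3 L, (2 - ((su2Rep (P.2 x * (R.2 x)⁻¹)).trace).re) := Finset.sum_nonneg fun x _ => hseam_nonneg x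
  have hD0 : 0 ≤ D := le_trans (add_nonneg hS1 hS2) hD
  refine ⟨fun i e => ?_, fun x => ?_⟩
  · have h0 : ‖su2Quat (P.1 i e) - su2Quat (R.1 i e)‖ ^ 2 ≤ D := by
      calc ‖su2Quat (P.1 i e) - su2Quat (R.1 i e)‖ ^ 2
          ≤ ∑ e' : Edge 3 L, ‖su2Quat (P.1 i e') - su2Quat (R.1 i e')‖ ^ 2 :=
            Finset.single_le_sum (f := fun e' : Edge 3 L => ‖su2Quat (P.1 i e') - su2Quat (R.1 i e')‖ ^ 2) (fun _ _ => by positivity)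
              (Finset.mem_univ e)
        _ = 6 * (L : ℝ) ^ 3 - timeCoupling su2Rep (P.1 i) (R.1 i) := (timeCoupling_deficit_eq _ _).symm
        _ ≤ ∑ j : Fin (2 * L - 1 + 1), (6 * (L : ℝ) ^ 3 - timeCoupling su2Rep (P.1 j) (R.1 j)) :=
            Finset.single_le_sum (f := fun j : Fin (2 * L - 1 + 1) => 6 * (L : ℝ) ^ 3 - timeCoupling su2Rep (P.1 j) (R.1 j))
              (fun j _ => hslice_nonneg j) (Finset.mem_univ i)
        _ ≤ D := by linarith
    have h1 : ‖su2Quat (P.1 i e) - su2Quat (R.1 i e)‖ ≤ Real.sqrt D := (Real.le_sqrt (norm_nonneg _) hD0).2 h0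
    linarith [fd_le_two_mul_norm_su2Quat_sub (P.1 i e) (R.1 i e)]
  · have h0 : ‖su2Quat (P.2 x) - su2Quat (R.2 x)‖ ^ 2 ≤ D := by
      rw [← hseam_eq]
      calc 2 - ((su2Rep (P.2 x * (R.2 x)⁻¹)).trace).re
          ≤ ∑ y : Site 3 L, (2 - ((su2Rep (P.2 y * (R.2 y)⁻¹)).trace).re) :=
            Finset.single_le_sum (f := fun y : Site 3 L => 2 - ((su2Rep (P.2 y * (R.2 y)⁻¹)).trace).re) (fun y _ => hseam_nonneg y)
              (Finset.mem_univ x)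
        _ ≤ D := by linarith
    have h1 : ‖su2Quat (P.2 x) - su2Quat (R.2 x)‖ ≤ Real.sqrt D := (Real.le_sqrt (norm_nonneg _) hD0).2 h0
    linarith [fd_le_two_mul_norm_su2Quat_sub (P.2 x) (R.2 x)]

end Summit.QuantumFields.YangMills.Theorems.VirialFluxGap.RingDeficit

end
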